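import Literature.Probability.Percolation.SepArmsOnScheme
import Literature.Probability.Percolation.ArmEventsStructure
import HarnessLib

/-!
# The separation step "by independence", once for every arm pattern

Topic: Probability / Percolation; family `crit-perc` (critical site percolation on the triangular
lattice `𝕋`; hexagonal annuli `Λ_N ∖ Λ_n`, `Λ_n = triBall n`, `|·| = triNorm`). A brick toward the
named fact `Literature.Probability.Percolation.Nolin2008_prop17_quasiMult` (P. Nolin, *Near-critical
percolation in two dimensions*, EJP 13 (2008), §4.5 Prop. 17 [arXiv 0711.4948: Prop. 16]), PROOFS
ONLY. `SepArmsOnScheme.lean` reduces Nolin's arm-separation theorem (Thm. 11 [arXiv Thm. 10]) for an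
arbitrary pattern `(κ, s)` — hence the clause of the fact at `κ`
(`polyArmProb_quasiMult_of_surgeries`) — to two pattern-specific inputs `hOut` / `hIn`, each a pair
"surgery with failure rate `ε` by independence" + "landing at constant cost". The first half of each
pair is the same computation for every pattern (Nolin, §4.4, p. 12: "`A_{j,σ}(2^k,2^K) ⊆
Ã^{·/η'}(2^k,2^K) ∪ ({one of the four U fails} ∩ A_{j,σ}(2^k,2^{K-1}))`. Hence, by independence of
the two latter events, `P(A(2^k,2^K)) ≤ P(Ã(2^k,2^K)) + 4δ P(A(2^k,2^{K-1}))`"; the tree's instances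
`real_le_adjStep_at`, `real_le_mul_outMidTiny_add`). This file does it once and for all, so that a
pattern-specific development only has to deliver, for every `ε > 0`:

* OUTER: a good event `Good M` of the configuration OFF `Λ_M` (determined by a finite set of sites
  disjoint from `Λ_M`) with `P_{1/2}((Good M)ᶜ) ≤ ε`, and ONE landing inequality
  `P_{1/2}(armEvent κ n (2M) ∩ Good M) ≤ C₁ · P_{1/2}(extArmsOn κ s n (4M))` (`n ≥ n₀`, `2n ≤ M`) —
  `outerSurgery_of_goodEvent` turns this into `hOut`;
* INNER: a good event `GoodIn m` of the configuration INSIDE `Λ_{2m}` (determined by `triBall (2m)`)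
  with `P_{1/2}((GoodIn m)ᶜ) ≤ ε`, and ONE landing inequality
  `P_{1/2}(extArmsOn κ s (2m+1) N ∩ GoodIn m) ≤ C₁ · P_{1/2}(sepArmsOn κ s m N)` (`m ≥ n₀`,
  `2(2m+1) ≤ N`) — `innerSurgery_of_goodEvent` turns this into `hIn`;

and `sepArmsOn_separation_of_goodEvents` / `polyArmProb_quasiMult_of_goodEvents` conclude
(`c · polyArmProb κ n N ≤ P_{1/2}(sepArmsOn κ s n N)`, resp. the clause of
`Nolin2008_prop17_quasiMult` at `κ`). Locality inputs: `determinedBy_armEvent` (arms of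
`armEvent κ n M` live in `triAnnulus n M ⊆ Λ_M`), `determinedBy_extArmsOnCol` (the outer-landed event
from `∂Λ_m` lives on sites of norm `≥ m`), and independence of events determined by disjoint finite
sets of sites (`sitePercolation_real_inter_of_disjoint`).

Everything is proved; no named fact is introduced (D-0026).

## References

* P. Nolin, *Near-critical percolation in two dimensions*, Electron. J. Probab. 13 (2008)
  1562–1623, §4.4, proof of Thm. 11, "by independence of the two latter events" (arXiv 0711.4948:
  Thm. 10, pp. 12–13), §4.5 Prop. 17 [arXiv Prop. 16]. [Nolin2008]
* H. Kesten, *Scaling relations for 2D-percolation*, Comm. Math. Phys. 109 (1987), Lemma 2 (the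
  induction over scales). [Kesten1987]
* G. Grimmett, *Percolation*, 2nd ed. (1999), §2.2 (events determined by finitely many sites are
  independent when the sets are disjoint). [GrimmettPercolation1999]

Tree: `exists_real_le_mul_extArmsOn_of_outerSurgery`, `exists_real_extArmsOn_le_mul_sepArmsOn_of_innerSurgery`,
`sepArmsOn_separation_of_surgeries`, `polyArmProb_quasiMult_of_surgeries`, `extArmsOn_mono`
(`SepArmsOnScheme.lean`); `extArmsOn_eq_inter`, `determinedBy_extArmsOnCol` (`ExtArmsOn.lean`);
`determinedBy_armEvent` (`ArmEventsStructure.lean`); `triNorm_rot` (`ArmSeparationRotate.lean`); `armEvent_mono_holds`; `DeterminedBy.mono/.inter/.compl`;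
`sitePercolation_real_inter_of_disjoint` (`SitePercolationMeasure.lean`).
-/

noncomputable section

open MeasureTheory Set

namespace Literature.Probability.Percolation

open LatticeModels

variable {k : ℕ}

/-! ### Locality of the two arm events on hexagonal balls / their complements -/

/-- The arms of `armEvent κ n M` live in `Λ_M`. [folklore] -/
theorem determinedBy_armEvent_triBall (κ : Fin k → Bool) {n M : ℕ} (hnM : n ≤ M) :
    DeterminedBy (armEvent κ n M) ↑(triBall M) := by
  refine (determinedBy_armEvent κ hnM).mono ?_
  intro v hv
  rw [Finset.mem_coe, mem_triAnnulus] at hv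
  rw [Finset.mem_coe, mem_triBall_iff]
  exact hv.2

/-- The outer-landed event from `∂Λ_m` lives on the sites of norm in `[m, N + N/8]` (`2m ≤ N`). [folklore] -/
theorem determinedBy_extArmsOn_triAnnulus (κ : Fin k → Bool) (s : Fin k → Fin 6) {m N : ℕ} (hmN : 2 * m ≤ N) :
    DeterminedBy (extArmsOn κ s m N) ↑(triAnnulus m (N + N / 8)) := by
  have hF : ∀ b : Bool, ∀ j : Fin k, κ j = b →
      triRotIsoPow (s j).val '' extConeSet m N ⊆ (↑(triAnnulus m (N + N / 8)) : Set (Site 2)) := by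
    intro b j _ v hv
    obtain ⟨w, hw, rfl⟩ := hv
    rw [mem_extConeSet] at hw
    rw [Finset.mem_coe, mem_triAnnulus, triNorm_rot]
    exact ⟨hw.1, by push_cast; exact hw.2.1⟩
  rw [extArmsOn_eq_inter]
  exact (determinedBy_extArmsOnCol κ s true hmN (hF true)).inter (determinedBy_extArmsOnCol κ s false hmN (hF false))

/-- `Λ_{M'}` is disjoint from the sites of norm `≥ m` as soon as `M' < m`. [folklore] -/
theorem disjoint_triBall_triAnnulus {M' m X : ℕ} (h : M' < m) : Disjoint (triBall M') (triAnnulus m X) := by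
  rw [Finset.disjoint_left]
  intro v hv hv'
  rw [mem_triBall_iff] at hv
  rw [mem_triAnnulus] at hv'
  have : (M' : ℤ) < m := by exact_mod_cast h
  omega

/-! ### The step "by independence" -/

/-- **The separation step "by independence", abstract form** (Nolin 2008, §4.4, p. 12; Kesten 1987,
Lemma 2): if `E ⊆ (E ∩ Good) ∪ (Goodᶜ ∩ A)` — which holds as soon as `E ⊆ A` — with `Goodᶜ` and `A`
determined by disjoint finite sets of sites, then
`P_{1/2}(E) ≤ P_{1/2}(E ∩ Good) + P_{1/2}(Goodᶜ) · P_{1/2}(A)`. [cite: Nolin2008, §4.4 Thm. 11 (proof) (arXiv 0711.4948: Thm. 10, p. 12, "by independence")] -/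
theorem real_le_real_inter_add_mul_of_determinedBy {E Good A : Set (SiteConfig (Site 2))} {F G : Finset (Site 2)}
    (hEA : E ⊆ A) (hGood : DeterminedBy Good ↑F) (hA : DeterminedBy A ↑G) (hFG : Disjoint F G) :
    (triSitePercolation half).real E ≤
      (triSitePercolation half).real (E ∩ Good) + (triSitePercolation half).real Goodᶜ * (triSitePercolation half).real A := by
  have hsub : E ⊆ (E ∩ Good) ∪ (Goodᶜ ∩ A) := by
    intro ω hω
    by_cases hg : ω ∈ Good
    · exact Or.inl ⟨hω, hg⟩
    · exact Or.inr ⟨hg, hEA hω⟩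
  have hind := sitePercolation_real_inter_of_disjoint half hGood.compl hA hFG
  unfold triSitePercolation at hind ⊢
  calc (sitePercolation (Site 2) half).real E
      ≤ (sitePercolation (Site 2) half).real ((E ∩ Good) ∪ (Goodᶜ ∩ A)) := measureReal_mono hsub (measure_ne_top _ _)
    _ ≤ (sitePercolation (Site 2) half).real (E ∩ Good) + (sitePercolation (Site 2) half).real (Goodᶜ ∩ A) :=
        measureReal_union_le _ _
    _ = _ := by rw [hind]

/-! ### The outer input `hOut` from a good event off `Λ_M` and one landing inequality -/

/-- **The outer surgery input of `SepArmsOnScheme.lean` from a good event and a landing bound.**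
Suppose that for every `ε > 0` there are good events `Good M`, determined by finite sets `S M` of
sites disjoint from `Λ_M`, with `P_{1/2}((Good M)ᶜ) ≤ ε` for `M ≥ n₀`, and a constant `C₁ ≥ 0` with
`P_{1/2}(armEvent κ n (2M) ∩ Good M) ≤ C₁ · P_{1/2}(extArmsOn κ s n (4M))` for `n ≥ n₀`, `2n ≤ M`
(the surgery in the annulus `(M, 2M]` on the good event, followed by the landing on the next
scale). Then the hypothesis `hOut` of `exists_real_le_mul_extArmsOn_of_outerSurgery` holds for
`A = armEvent κ`, with `G n M = armEvent κ n (2M) ∩ Good M`: "by independence",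
`P(A n (2M)) ≤ P(G n M) + ε P(A n M)`. [cite: Nolin2008, §4.4 Thm. 11 (proof), external extremities (arXiv 0711.4948: Thm. 10, p. 12)] -/
theorem outerSurgery_of_goodEvent (κ : Fin k → Bool) (s : Fin k → Fin 6)
    (h : ∀ ε : ℝ, 0 < ε → ∃ (Good : ℕ → Set (SiteConfig (Site 2))) (S : ℕ → Finset (Site 2)) (C₁ : ℝ) (n₀ : ℕ),
      0 ≤ C₁ ∧
      (∀ M : ℕ, n₀ ≤ M → DeterminedBy (Good M) ↑(S M) ∧ Disjoint (S M) (triBall M) ∧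
        (triSitePercolation half).real (Good M)ᶜ ≤ ε) ∧
      (∀ n M : ℕ, n₀ ≤ n → 2 * n ≤ M →
        (triSitePercolation half).real (armEvent κ n (2 * M) ∩ Good M) ≤
          C₁ * (triSitePercolation half).real (extArmsOn κ s n (4 * M)))) :
    ∀ ε : ℝ, 0 < ε → ∃ (G : ℕ → ℕ → Set (SiteConfig (Site 2))) (C₁ : ℝ) (n₀ : ℕ), 0 ≤ C₁ ∧
      (∀ n M : ℕ, n₀ ≤ n → 2 * n ≤ M →
        (triSitePercolation half).real (armEvent κ n (2 * M)) ≤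
          (triSitePercolation half).real (G n M) + ε * (triSitePercolation half).real (armEvent κ n M)) ∧
      (∀ n M : ℕ, n₀ ≤ n → 2 * n ≤ M →
        (triSitePercolation half).real (G n M) ≤ C₁ * (triSitePercolation half).real (extArmsOn κ s n (4 * M))) := by
  intro ε hε
  obtain ⟨Good, S, C₁, n₀, hC₁, hG, hL⟩ := h ε hε
  refine ⟨fun n M => armEvent κ n (2 * M) ∩ Good M, C₁, n₀, hC₁, fun n M hn hM => ?_, fun n M hn hM => hL n M hn hM⟩
  obtain ⟨hdet, hdisj, hfail⟩ := hG M (by omega)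
  have hEA : armEvent κ n (2 * M) ⊆ armEvent κ n M := armEvent_mono_holds κ (by omega) (by omega)
  have hstep := real_le_real_inter_add_mul_of_determinedBy hEA hdet (determinedBy_armEvent_triBall κ (by omega)) hdisj
  refine hstep.trans (add_le_add le_rfl ?_)
  exact mul_le_mul_of_nonneg_right hfail measureReal_nonneg

/-! ### The inner input `hIn` from a good event inside `Λ_{2m}` and one landing inequality -/

/-- **The inner surgery input of `SepArmsOnScheme.lean` from a good event and a landing bound.**
Suppose that for every `ε > 0` there are good events `GoodIn m`, determined by `Λ_{2m}`, with
`P_{1/2}((GoodIn m)ᶜ) ≤ ε` for `m ≥ n₀`, and a constant `C₁ ≥ 0` with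
`P_{1/2}(extArmsOn κ s (2m+1) N ∩ GoodIn m) ≤ C₁ · P_{1/2}(sepArmsOn κ s m N)` for `m ≥ n₀`,
`2(2m+1) ≤ N` (the surgery in the annulus `[m, 2m]` on the good event, for the outer-landed arms
issued from `∂Λ_{2m+1}`). Then the hypothesis `hIn` of
`exists_real_extArmsOn_le_mul_sepArmsOn_of_innerSurgery` holds, with
`G i N = extArmsOn κ s i N ∩ GoodIn ((i - 1)/2)` (so that `G (2m+1) N = extArmsOn κ s (2m+1) N ∩ GoodIn m`)
and threshold `2n₀ + 1`: "by independence" (the outer-landed event from `∂Λ_i` lives on sites of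
norm `≥ i`, the good event on `Λ_{i-1}`) and `extArmsOn κ s m N ⊆ extArmsOn κ s (2m+1) N`,
`P(ext m N) ≤ P(G m N) + ε P(ext (2m+1) N)`. [cite: Nolin2008, §4.4 Thm. 11 (proof), internal extremities (arXiv 0711.4948: Thm. 10, p. 13)] -/
theorem innerSurgery_of_goodEvent (κ : Fin k → Bool) (s : Fin k → Fin 6)
    (h : ∀ ε : ℝ, 0 < ε → ∃ (GoodIn : ℕ → Set (SiteConfig (Site 2))) (C₁ : ℝ) (n₀ : ℕ), 0 ≤ C₁ ∧
      (∀ m : ℕ, n₀ ≤ m → DeterminedBy (GoodIn m) ↑(triBall (2 * m)) ∧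
        (triSitePercolation half).real (GoodIn m)ᶜ ≤ ε) ∧
      (∀ m N : ℕ, n₀ ≤ m → 2 * (2 * m + 1) ≤ N →
        (triSitePercolation half).real (extArmsOn κ s (2 * m + 1) N ∩ GoodIn m) ≤
          C₁ * (triSitePercolation half).real (sepArmsOn κ s m N))) :
    ∀ ε : ℝ, 0 < ε → ∃ (G : ℕ → ℕ → Set (SiteConfig (Site 2))) (C₁ : ℝ) (n₀ : ℕ), 0 ≤ C₁ ∧
      (∀ m N : ℕ, n₀ ≤ m → 2 * (2 * m + 1) ≤ N →
        (triSitePercolation half).real (extArmsOn κ s m N) ≤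
          (triSitePercolation half).real (G m N) + ε * (triSitePercolation half).real (extArmsOn κ s (2 * m + 1) N)) ∧
      (∀ m N : ℕ, n₀ ≤ m → 2 * (2 * m + 1) ≤ N →
        (triSitePercolation half).real (G (2 * m + 1) N) ≤ C₁ * (triSitePercolation half).real (sepArmsOn κ s m N)) := by
  intro ε hε
  obtain ⟨GoodIn, C₁, n₀, hC₁, hG, hL⟩ := h ε hε
  refine ⟨fun i N => extArmsOn κ s i N ∩ GoodIn ((i - 1) / 2), C₁, 2 * n₀ + 1, hC₁, fun m N hm hN => ?_, fun m N hm hN => ?_⟩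
  · -- by independence: `GoodIn ((m-1)/2)` lives on `Λ_{2((m-1)/2)} ⊆ Λ_{m-1}`, `extArmsOn κ s m N` on norms `≥ m`
    have hm' : n₀ ≤ (m - 1) / 2 := by omega
    obtain ⟨hdet, hfail⟩ := hG ((m - 1) / 2) hm'
    have hEA : extArmsOn κ s m N ⊆ extArmsOn κ s m N := Subset.rfl
    have hdisj : Disjoint (triBall (2 * ((m - 1) / 2))) (triAnnulus m (N + N / 8)) :=
      disjoint_triBall_triAnnulus (by omega)
    have hstep := real_le_real_inter_add_mul_of_determinedBy hEA hdet
      (determinedBy_extArmsOn_triAnnulus κ s (by omega)) hdisj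
    refine hstep.trans (add_le_add le_rfl ?_)
    have hmono : (triSitePercolation half).real (extArmsOn κ s m N) ≤
        (triSitePercolation half).real (extArmsOn κ s (2 * m + 1) N) :=
      measureReal_mono (extArmsOn_mono κ s (by omega) (by omega)) (measure_ne_top _ _)
    exact mul_le_mul hfail hmono measureReal_nonneg hε.le
  · -- the landing inequality, re-indexed
    have e : (2 * m + 1 - 1) / 2 = m := by omega
    show (triSitePercolation half).real (extArmsOn κ s (2 * m + 1) N ∩ GoodIn ((2 * m + 1 - 1) / 2)) ≤ _
    rw [e]
    exact hL m N (by omega) hN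

/-! ### Separation and quasi-multiplicativity from the two good events -/

/-- **Arm separation for an arbitrary pattern from the two good events and the two landing
inequalities** (Nolin 2008, Thm. 11 [arXiv Thm. 10] at `p = 1/2`, modulo its pattern-specific
surgery/landing content): `sepArmsOn_separation_of_surgeries` fed with `outerSurgery_of_goodEvent`
and `innerSurgery_of_goodEvent`. The conclusion is the hypothesis `hsep` of
`polyArmProb_quasiMult_of_sepArmsOn_separation`. [cite: Nolin2008, §4.4 Thm. 11 (arXiv 0711.4948: Thm. 10, pp. 11–13)] -/
theorem sepArmsOn_separation_of_goodEvents (κ : Fin k → Bool) (s : Fin k → Fin 6) (hs : Function.Injective s)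
    (hOut : ∀ ε : ℝ, 0 < ε → ∃ (Good : ℕ → Set (SiteConfig (Site 2))) (S : ℕ → Finset (Site 2)) (C₁ : ℝ) (n₀ : ℕ),
      0 ≤ C₁ ∧
      (∀ M : ℕ, n₀ ≤ M → DeterminedBy (Good M) ↑(S M) ∧ Disjoint (S M) (triBall M) ∧
        (triSitePercolation half).real (Good M)ᶜ ≤ ε) ∧
      (∀ n M : ℕ, n₀ ≤ n → 2 * n ≤ M →
        (triSitePercolation half).real (armEvent κ n (2 * M) ∩ Good M) ≤
          C₁ * (triSitePercolation half).real (extArmsOn κ s n (4 * M))))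
    (hIn : ∀ ε : ℝ, 0 < ε → ∃ (GoodIn : ℕ → Set (SiteConfig (Site 2))) (C₁ : ℝ) (n₀ : ℕ), 0 ≤ C₁ ∧
      (∀ m : ℕ, n₀ ≤ m → DeterminedBy (GoodIn m) ↑(triBall (2 * m)) ∧
        (triSitePercolation half).real (GoodIn m)ᶜ ≤ ε) ∧
      (∀ m N : ℕ, n₀ ≤ m → 2 * (2 * m + 1) ≤ N →
        (triSitePercolation half).real (extArmsOn κ s (2 * m + 1) N ∩ GoodIn m) ≤
          C₁ * (triSitePercolation half).real (sepArmsOn κ s m N))) :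
    ∃ c : ℝ, 0 < c ∧ ∃ n₀ : ℕ, ∀ n N : ℕ, n₀ ≤ n → 2 * n ≤ N →
      c * polyArmProb κ n N ≤ (triSitePercolation half).real (sepArmsOn κ s n N) :=
  sepArmsOn_separation_of_surgeries κ s hs (outerSurgery_of_goodEvent κ s hOut) (innerSurgery_of_goodEvent κ s hIn)

/-- **Quasi-multiplicativity of `polyArmProb κ` from the two good events and the two landing
inequalities** (Nolin 2008, Prop. 17 [arXiv Prop. 16] for the pattern `κ`, modulo the
pattern-specific surgery/landing content of Thm. 11 on the sides `s`). The conclusion is the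
clause of `Nolin2008_prop17_quasiMult` at `κ`. [cite: Nolin2008, §4.5 Prop. 17 and §4.4 Thm. 11 (arXiv 0711.4948: Prop. 16, Thm. 10)] -/
theorem polyArmProb_quasiMult_of_goodEvents (κ : Fin k → Bool) (s : Fin k → Fin 6) (hs : Function.Injective s)
    (hOut : ∀ ε : ℝ, 0 < ε → ∃ (Good : ℕ → Set (SiteConfig (Site 2))) (S : ℕ → Finset (Site 2)) (C₁ : ℝ) (n₀ : ℕ),
      0 ≤ C₁ ∧
      (∀ M : ℕ, n₀ ≤ M → DeterminedBy (Good M) ↑(S M) ∧ Disjoint (S M) (triBall M) ∧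
        (triSitePercolation half).real (Good M)ᶜ ≤ ε) ∧
      (∀ n M : ℕ, n₀ ≤ n → 2 * n ≤ M →
        (triSitePercolation half).real (armEvent κ n (2 * M) ∩ Good M) ≤
          C₁ * (triSitePercolation half).real (extArmsOn κ s n (4 * M))))
    (hIn : ∀ ε : ℝ, 0 < ε → ∃ (GoodIn : ℕ → Set (SiteConfig (Site 2))) (C₁ : ℝ) (n₀ : ℕ), 0 ≤ C₁ ∧
      (∀ m : ℕ, n₀ ≤ m → DeterminedBy (GoodIn m) ↑(triBall (2 * m)) ∧
        (triSitePercolation half).real (GoodIn m)ᶜ ≤ ε) ∧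
      (∀ m N : ℕ, n₀ ≤ m → 2 * (2 * m + 1) ≤ N →
        (triSitePercolation half).real (extArmsOn κ s (2 * m + 1) N ∩ GoodIn m) ≤
          C₁ * (triSitePercolation half).real (sepArmsOn κ s m N))) :
    ∃ c : ℝ, 0 < c ∧ ∃ n₀ : ℕ, ∀ n₁ n₂ n₃ : ℕ, n₀ ≤ n₁ → n₁ < n₂ → n₂ < n₃ →
      c * (polyArmProb κ n₁ n₂ * polyArmProb κ n₂ n₃) ≤ polyArmProb κ n₁ n₃ :=
  polyArmProb_quasiMult_of_sepArmsOn_separation κ s hs (sepArmsOn_separation_of_goodEvents κ s hs hOut hIn)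

/-! ### The inner input with the good event at the scale of the arms -/

/-- **The inner surgery input of `SepArmsOnScheme.lean`, good event at the scale of the arms** —
the form an inner surgery actually produces: the outer-landed arms issued from `∂Λ_i` cross the
annulus `[i, 2i]`, the good event `GoodIn i` (explorations of the inner half-annuli, fences) is read
on `Λ_{2i}`, and the landing goes one scale down. Suppose that for every `ε > 0` there are events
`GoodIn i`, determined by `Λ_{2i}`, with `P_{1/2}((GoodIn i)ᶜ) ≤ ε` for `i ≥ n₀`, and `C₁ ≥ 0` with
`P_{1/2}(extArmsOn κ s (2m+1) N ∩ GoodIn (2m+1)) ≤ C₁ · P_{1/2}(sepArmsOn κ s m N)` for `m ≥ n₀`,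
`2(2m+1) ≤ N`. Then the hypothesis `hIn` of `exists_real_extArmsOn_le_mul_sepArmsOn_of_innerSurgery`
holds with `G i N = extArmsOn κ s i N ∩ GoodIn i`: by independence (`GoodIn m` lives on `Λ_{2m}`,
`extArmsOn κ s (2m+1) N` on sites of norm `≥ 2m+1`) and `extArmsOn κ s m N ⊆ extArmsOn κ s (2m+1) N`,
`P(ext m N) ≤ P(ext m N ∩ GoodIn m) + P((GoodIn m)ᶜ) · P(ext (2m+1) N)` — the shape of the tree's
two-arm inner step `real_extTwoArm_le_step`. (In `innerSurgery_of_goodEvent` the good event of the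
landing clause is indexed one scale lower, which makes that clause a pure inward-extension
statement; this is the version to feed with a surgery.) [cite: Nolin2008, §4.4 Thm. 11 (proof), internal extremities (arXiv 0711.4948: Thm. 10, p. 13)] -/
theorem innerSurgery_of_goodEvent' (κ : Fin k → Bool) (s : Fin k → Fin 6)
    (h : ∀ ε : ℝ, 0 < ε → ∃ (GoodIn : ℕ → Set (SiteConfig (Site 2))) (C₁ : ℝ) (n₀ : ℕ), 0 ≤ C₁ ∧
      (∀ i : ℕ, n₀ ≤ i → DeterminedBy (GoodIn i) ↑(triBall (2 * i)) ∧
        (triSitePercolation half).real (GoodIn i)ᶜ ≤ ε) ∧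
      (∀ m N : ℕ, n₀ ≤ m → 2 * (2 * m + 1) ≤ N →
        (triSitePercolation half).real (extArmsOn κ s (2 * m + 1) N ∩ GoodIn (2 * m + 1)) ≤
          C₁ * (triSitePercolation half).real (sepArmsOn κ s m N))) :
    ∀ ε : ℝ, 0 < ε → ∃ (G : ℕ → ℕ → Set (SiteConfig (Site 2))) (C₁ : ℝ) (n₀ : ℕ), 0 ≤ C₁ ∧
      (∀ m N : ℕ, n₀ ≤ m → 2 * (2 * m + 1) ≤ N →
        (triSitePercolation half).real (extArmsOn κ s m N) ≤
          (triSitePercolation half).real (G m N) + ε * (triSitePercolation half).real (extArmsOn κ s (2 * m + 1) N)) ∧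
      (∀ m N : ℕ, n₀ ≤ m → 2 * (2 * m + 1) ≤ N →
        (triSitePercolation half).real (G (2 * m + 1) N) ≤ C₁ * (triSitePercolation half).real (sepArmsOn κ s m N)) := by
  intro ε hε
  obtain ⟨GoodIn, C₁, n₀, hC₁, hG, hL⟩ := h ε hε
  refine ⟨fun i N => extArmsOn κ s i N ∩ GoodIn i, C₁, n₀, hC₁, fun m N hm hN => ?_, fun m N hm hN => hL m N hm hN⟩
  obtain ⟨hdet, hfail⟩ := hG m hm
  have hEA : extArmsOn κ s m N ⊆ extArmsOn κ s (2 * m + 1) N := extArmsOn_mono κ s (by omega) (by omega)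
  have hdisj : Disjoint (triBall (2 * m)) (triAnnulus (2 * m + 1) (N + N / 8)) := disjoint_triBall_triAnnulus (by omega)
  have hstep := real_le_real_inter_add_mul_of_determinedBy hEA hdet
    (determinedBy_extArmsOn_triAnnulus κ s (by omega)) hdisj
  refine hstep.trans (add_le_add le_rfl ?_)
  exact mul_le_mul_of_nonneg_right hfail measureReal_nonneg

/-- **Quasi-multiplicativity of `polyArmProb κ` from the two good events**, inner good event at the
scale of the arms (`innerSurgery_of_goodEvent'`). [cite: Nolin2008, §4.5 Prop. 17 and §4.4 Thm. 11 (arXiv 0711.4948: Prop. 16, Thm. 10)] -/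
theorem polyArmProb_quasiMult_of_goodEvents' (κ : Fin k → Bool) (s : Fin k → Fin 6) (hs : Function.Injective s)
    (hOut : ∀ ε : ℝ, 0 < ε → ∃ (Good : ℕ → Set (SiteConfig (Site 2))) (S : ℕ → Finset (Site 2)) (C₁ : ℝ) (n₀ : ℕ),
      0 ≤ C₁ ∧
      (∀ M : ℕ, n₀ ≤ M → DeterminedBy (Good M) ↑(S M) ∧ Disjoint (S M) (triBall M) ∧
        (triSitePercolation half).real (Good M)ᶜ ≤ ε) ∧
      (∀ n M : ℕ, n₀ ≤ n → 2 * n ≤ M →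
        (triSitePercolation half).real (armEvent κ n (2 * M) ∩ Good M) ≤
          C₁ * (triSitePercolation half).real (extArmsOn κ s n (4 * M))))
    (hIn : ∀ ε : ℝ, 0 < ε → ∃ (GoodIn : ℕ → Set (SiteConfig (Site 2))) (C₁ : ℝ) (n₀ : ℕ), 0 ≤ C₁ ∧
      (∀ i : ℕ, n₀ ≤ i → DeterminedBy (GoodIn i) ↑(triBall (2 * i)) ∧
        (triSitePercolation half).real (GoodIn i)ᶜ ≤ ε) ∧
      (∀ m N : ℕ, n₀ ≤ m → 2 * (2 * m + 1) ≤ N →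
        (triSitePercolation half).real (extArmsOn κ s (2 * m + 1) N ∩ GoodIn (2 * m + 1)) ≤
          C₁ * (triSitePercolation half).real (sepArmsOn κ s m N))) :
    ∃ c : ℝ, 0 < c ∧ ∃ n₀ : ℕ, ∀ n₁ n₂ n₃ : ℕ, n₀ ≤ n₁ → n₁ < n₂ → n₂ < n₃ →
      c * (polyArmProb κ n₁ n₂ * polyArmProb κ n₂ n₃) ≤ polyArmProb κ n₁ n₃ :=
  polyArmProb_quasiMult_of_sepArmsOn_separation κ s hs
    (sepArmsOn_separation_of_surgeries κ s hs (outerSurgery_of_goodEvent κ s hOut) (innerSurgery_of_goodEvent' κ s hIn))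

end Literature.Probability.Percolation

end
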